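import Summits.HodgeConjecture.FermatCycles.ConditionQFourfoldSearch
import Summits.HodgeConjecture.FermatCycles.ConditionQFourfoldSixtyEightA
import HarnessLib

/-!
# Shioda's stable-generation condition `(Q⁴ₘ)` at `m = 68` and the failure of `(P⁴ₘ)` — kernel certificate (part B of 2)

HONEST FRAMING: explicit algebraic cycles for specific Hodge classes on Fermat/Delsarte varieties;
residual open instances listed; no claim on general Hodge.

Topic path `Summits/HodgeConjecture/FermatCycles/` of cell `pub-hfermat` (new work, not literature: a computer determination of the cell —
`pub-hfermat-enum/P4-TABLE.md` §(Q⁴ₘ), two implementations — certified by the Lean kernel). Framework: `ConditionQFourfold.lean`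
(certificate Booleans, searches `checkQU`/`checkQN`) and `ConditionQFourfoldSearch.lean` (`conditionQ_four_of_normalized`).

THE STATEMENT. Shioda, Math. Ann. 245 (1979) §4 p. 183: `(Qⁿₘ)` — every element of `Mₘ(y)`, `3 ≤ y ≤ n/2 + 1`, is `ξ₁ − ξ₂` with
`ξ₁, ξ₂ ∈ M'ₘ = ⟨Mₘ(1), Mₘ(2), Mₘ(3)^sd⟩` (pairs, Hodge classes of the Fermat surface, semi-decomposable sextuples); by his Claim
(p. 183, Lemmas 2–3) `(Qⁿₘ)` may replace `(Pⁿₘ)` in Theorem III (`⇒` the Hodge conjecture for `Xⁿₘ`); p. 184: "we do not know any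
value of `m` which satisfies `(Qₘ)` but not `(Pₘ)`". Tree: `Literature.AlgebraicGeometry.Shioda1979.ConditionQ m n`, `MPrime`,
`forall_of_conditionQ` (the Claim's arithmetic spine), `ConditionP` (Math. Ann. form of `(P)`), `FermatCharacter.ShiodaConditionUpTo`
(Proc. Japan Acad. form, with the semi-decomposable alternative).

WHAT IS PROVED HERE (level `m = 68`, part B).
* part B of 2: the kernel searches `checkQN 68 T 1 11`, `checkQN 68 T 12 56` (103143 tuples);
* **`conditionQ_sixtyEight_four : Shioda1979.ConditionQ 68 4`** — `(Q⁴ₘ)` holds at `m = 68`: every Hodge sextuple over `ℤ/68` (every Hodge character of the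
  Fermat fourfold `X⁴ₘ`, `m = 68`, up to permutation) is `ξ₁ − ξ₂`, `ξᵢ ∈ M'ₘ`;
* `forall_of_closed_cancellative_sixtyEight`: by Shioda's Claim (`forall_of_conditionQ`), every Shioda-closed, Lemma-3-cancellative family of
  multisets over `ℤ/68` contains every non-empty Hodge multiset of cardinality `≤ 6`;
* the NEGATIVE side on the sextuple `s = (1, 18, 35, 38, 52, 60)`: Hodge (`isHodgeMultiset_fail_sixtyEight`), no proper non-empty sub-multiset with
  zero sum (`sum_ne_zero_of_mem_powerset_fail_sixtyEight`: hence not decomposable, not semi-decomposable), not quasi-decomposable (`fail_sixtyEight_key`,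
  `68 · 2⁸` kernel cases) ⇒ **`not_shiodaConditionUpTo_sixtyEight_four : ¬ ShiodaConditionUpTo 68 4`** (the Proc. Japan Acad. form of `(P⁴ₘ)`
  fails), `not_conditionP_sixtyEight_four : ¬ Shioda1979.ConditionP 68 4` (the Math. Ann. form fails), and the conjunction
  `conditionQ_not_conditionP_sixtyEight : ConditionQ 68 4 ∧ ¬ ConditionP 68 4` — at `m = 68`, for fourfolds, Shioda's weakening `(Q)` of `(P)` is
  NECESSARY as well as sufficient.

NUMBERS (this seat's search `code/lit/q4/q4norm.py` = implementation 2; implementation 1 = ENUM `code/enum/q4table.py`,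
`data/shioda_Q4_m3-100.json`): case U visits 88557 sorted tuples and case N 57512; 2622 of them are Hodge sextuples; all but 1 carry a
`(P)`-witness (case N pair 1716, case N quasi 112, case N semi 32, case U pair 725, case U quasi 33, case U semi 3); the other 1 — `(1, 18, 35, 38, 52, 60)` (case U) — carry the table
certificate(s) written out in the statements below (generators checked by `genB`, the identity `s + ΣX = ΣY` by `decide`, all inside the kernel search).

PRINT STATUS (lit seat, 2026-08-20). `68 = 4·17`: NO refereed theorem gives the Hodge conjecture for `X⁴₆₈` (not prime / `≤ 21` / prime power / `2pᵉ` / `{2,3,5,7}`-smooth; even). The cell settles `(68, 4)` by Lemma 3 cancellation (TABLE.md E3, two implementations; `(68, 8)` is one of the cell's residual OPEN cells, `OpenCells.OpenCell_68_8`, untouched here); this file makes `(Q⁴₆₈)` a kernel theorem, so HC(X⁴₆₈) follows from Shioda's printed Claim alone.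

References: [Shioda1979HodgeFermat] T. Shioda, Math. Ann. 245 (1979) 175–184, §3 p. 180 (`(Pⁿₘ)`), §4 pp. 183–184 (`M'ₘ`, `(Qⁿₘ)`, Claim,
the question); [Shioda1979PJA] T. Shioda, Proc. Japan Acad. 55A (1979) §1 (Definition (i)–(iii), `(Pⁿₘ)'`); [daSilva2021HodgeFermat]
G. da Silva Jr., Experimental Results 2 (2021) e22, Def. 2.4, Question 1; [Aoki2000FermatTypeRemarks] N. Aoki, Comment. Math. Univ.
St. Pauli 49 (2000), Thm 0.1. Cell: `pub-hfermat-enum/P4-TABLE.md`, `data/shioda_Q4_m3-100.json`, `code/lit/q4/` (this seat).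
-/

namespace Summit.HodgeConjecture.FermatCycles.ConditionQFourfold

open Multiset
open Literature.AlgebraicGeometry.HodgeTheory Literature.AlgebraicGeometry.HodgeTheory.FermatCharacter
open Literature.AlgebraicGeometry.Shioda1982 Literature.AlgebraicGeometry.Shioda1979
open Summit.HodgeConjecture.FermatCycles.ShiodaConditionFourfold

/-! ### Level `68` — part B -/

/-! The certificate table at level `68` (written out in every statement below, so that the files stay theorem-only): for each
sorted Hodge sextuple without a `(P)`-witness met by the search (key = its first five representatives), generator lists `X`, `Y` with
`s + ΣX = ΣY` (found by `code/lit/q4/q4norm.py`, checked here by the kernel). -/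

set_option maxHeartbeats 0 in
/-- The `(Q)`-search at level `68`, case N, first free representative in `[1, 12)` (62468 tuples). Kernel.
[cite: Shioda1979HodgeFermat, §4 condition (Qⁿₘ), p. 183] -/
theorem checkQN_68_1 :
    checkQN 68
      ([([1, 18, 35, 38, 52], [[2, 16, 33, 36, 50, 67]], [[1, 16, 52, 67], [18, 33, 35, 50], [2, 36, 38, 60]])] : List (List ℕ × List (List ℕ) × List (List ℕ)))
      1 11 = true := by
  decide +kernel

set_option maxHeartbeats 0 in
/-- The `(Q)`-search at level `68`, case N, first free representative in `[12, 68)` (40675 tuples). Kernel.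
[cite: Shioda1979HodgeFermat, §4 condition (Qⁿₘ), p. 183] -/
theorem checkQN_68_12 :
    checkQN 68
      ([([1, 18, 35, 38, 52], [[2, 16, 33, 36, 50, 67]], [[1, 16, 52, 67], [18, 33, 35, 50], [2, 36, 38, 60]])] : List (List ℕ × List (List ℕ) × List (List ℕ)))
      12 56 = true := by
  decide +kernel

/-- **`(Q⁴ₘ)` holds at `m = 68`**: every Hodge sextuple over `ℤ/68` is `ξ₁ − ξ₂` with `ξ₁, ξ₂ ∈ M'ₘ` (stably generated by pairs, Hodge
`4`-sets and semi-decomposable sextuples). Kernel certificate of the cell's entry `68 ∈ Q4_true_P4_false` (P4-TABLE §(Q⁴ₘ)).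
[cite: Shioda1979HodgeFermat, §4 condition (Qⁿₘ), p. 183] -/
theorem conditionQ_sixtyEight_four : ConditionQ 68 4 :=
  haveI : Fact (1 < 68) := ⟨by norm_num⟩
  conditionQ_four_of_normalized 68
    ([([1, 18, 35, 38, 52], [[2, 16, 33, 36, 50, 67]], [[1, 16, 52, 67], [18, 33, 35, 50], [2, 36, 38, 60]])] : List (List ℕ × List (List ℕ) × List (List ℕ)))
    [(1, 22), (23, 45)]
    (by
      intro b h0 hN
      rcases Nat.lt_or_ge b 23 with h0 | h0
      · exact ⟨(1, 22), by simp, by omega, by omega⟩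
      exact ⟨(23, 45), by simp, by omega, by omega⟩)
    (by
      intro p hp
      simp only [List.mem_cons, List.not_mem_nil, or_false] at hp
      rcases hp with rfl | rfl
      · exact checkQU_68_1
      · exact checkQU_68_23)
    [(1, 11), (12, 56)]
    (by
      intro a h0 hN
      rcases Nat.lt_or_ge a 12 with h0 | h0
      · exact ⟨(1, 11), by simp, by omega, by omega⟩
      exact ⟨(12, 56), by simp, by omega, by omega⟩)
    (by
      intro p hp
      simp only [List.mem_cons, List.not_mem_nil, or_false] at hp
      rcases hp with rfl | rfl
      · exact checkQN_68_1
      · exact checkQN_68_12)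

/-- **Shioda's Claim at `m = 68`**: every family of multisets over `ℤ/68` closed under the inductive structure of Fermat varieties
(pairs, surface classes, semi / star / hash) and under Lemma 3's cancellation contains every non-empty Hodge multiset with at most `6`
elements — the arithmetic form of "`(Q⁴ₘ)` ⇒ the Hodge conjecture for `X⁴ₘ`" at `m = 68` (geometric inputs = the hypotheses, as printed).
[cite: Shioda1979HodgeFermat, §4 Claim, Lemmas 2–3, p. 183] -/
theorem forall_of_closed_cancellative_sixtyEight {C : Multiset (ZMod 68) → Prop} (hC : IsShiodaClosed C) (hL : IsCancellative C) :
    ∀ s : Multiset (ZMod 68), s ≠ 0 → IsHodgeMultiset s → card s ≤ 6 → C s :=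
  forall_of_conditionQ hC hL conditionQ_sixtyEight_four

/-! ### The negative side at `m = 68`: `(P⁴ₘ)` fails on `s = (1, 18, 35, 38, 52, 60)` -/

/-- `s` is a Hodge sextuple over `ℤ/68` (a Hodge character of the Fermat fourfold of degree `68`). [cite: Shioda1979PJA, §1 eqs. (2)–(3)] -/
theorem isHodgeMultiset_fail_sixtyEight : IsHodgeMultiset ({1, 18, 35, 38, 52, 60} : Multiset (ZMod 68)) :=
  isHodgeMultiset_of_hodgeUB (N := 68) (by decide +kernel)

/-- Every proper non-empty sub-multiset of `s` has non-zero sum: `s` contains no pair `{a, −a}`, no Hodge sub-multiset, no zero-sum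
triple. [cite: Shioda1979PJA, §1 Definition (i), (iii)] -/
theorem sum_ne_zero_of_mem_powerset_fail_sixtyEight :
    ∀ t ∈ Multiset.powerset ({1, 18, 35, 38, 52, 60} : Multiset (ZMod 68)), t ≠ 0 → ({1, 18, 35, 38, 52, 60} : Multiset (ZMod 68)) - t ≠ 0 → t.sum ≠ 0 := by
  decide +kernel

/-- `s` is **not decomposable** (a summand would be a proper non-empty zero-sum sub-multiset). [cite: Shioda1979PJA, §1 Definition (i)] -/
theorem not_isDecomposable_fail_sixtyEight : ¬ IsDecomposable ({1, 18, 35, 38, 52, 60} : Multiset (ZMod 68)) := by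
  rintro ⟨t, u, ht0, hu0, ht, -, heq⟩
  have htle : t ≤ ({1, 18, 35, 38, 52, 60} : Multiset (ZMod 68)) := heq ▸ Multiset.le_add_right t u
  have hu : ({1, 18, 35, 38, 52, 60} : Multiset (ZMod 68)) - t = u := by rw [heq, add_tsub_cancel_left]
  exact sum_ne_zero_of_mem_powerset_fail_sixtyEight t (Multiset.mem_powerset.2 htle) ht0 (hu ▸ hu0) ht.1.2

/-- `s` is **not semi-decomposable** (no zero-sum triple). [cite: Shioda1979PJA, §1 Definition (iii)] -/
theorem not_isSemiDecomposable_fail_sixtyEight : ¬ IsSemiDecomposable ({1, 18, 35, 38, 52, 60} : Multiset (ZMod 68)) := by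
  rintro ⟨t, u, ht3, hu3, hts, -, heq⟩
  have htle : t ≤ ({1, 18, 35, 38, 52, 60} : Multiset (ZMod 68)) := heq ▸ Multiset.le_add_right t u
  have hu : ({1, 18, 35, 38, 52, 60} : Multiset (ZMod 68)) - t = u := by rw [heq, add_tsub_cancel_left]
  have ht0 : t ≠ 0 := by rintro rfl; simp at ht3
  have hu0 : u ≠ 0 := by rintro rfl; simp at hu3
  exact sum_ne_zero_of_mem_powerset_fail_sixtyEight t (Multiset.mem_powerset.2 htle) ht0 (hu ▸ hu0) hts

/-- A Hodge multiset over `ℤ/68` satisfies the finitely many conditions used by the kernel refutation below (entries non-zero, sum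
zero, Shioda's norm equation at the units `1, 3, 11, 5, 7, 13, 19` — a sub-family of Shioda's equations (2) that already admits no splitting, chosen by
`code/lit/q4/minunits.py`). [cite: Shioda1979PJA, §1 eq. (2)] -/
theorem hodgeConditions_sixtyEight {v : Multiset (ZMod 68)} (hv : IsHodgeMultiset v) :
    ((v).sum = 0 ∧ (∀ a ∈ v, a ≠ 0) ∧
            2 * mNormSum ((v).map fun a ↦ (1 : ZMod 68) * a) = 68 * Multiset.card (v) ∧
            2 * mNormSum ((v).map fun a ↦ (3 : ZMod 68) * a) = 68 * Multiset.card (v) ∧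
            2 * mNormSum ((v).map fun a ↦ (11 : ZMod 68) * a) = 68 * Multiset.card (v) ∧
            2 * mNormSum ((v).map fun a ↦ (5 : ZMod 68) * a) = 68 * Multiset.card (v) ∧
            2 * mNormSum ((v).map fun a ↦ (7 : ZMod 68) * a) = 68 * Multiset.card (v) ∧
            2 * mNormSum ((v).map fun a ↦ (13 : ZMod 68) * a) = 68 * Multiset.card (v) ∧
            2 * mNormSum ((v).map fun a ↦ (19 : ZMod 68) * a) = 68 * Multiset.card (v)) := by
  have h1 := hv.2 (Units.mkOfMulEqOne 1 1 (by decide))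
  have h3 := hv.2 (Units.mkOfMulEqOne 3 23 (by decide))
  have h11 := hv.2 (Units.mkOfMulEqOne 11 31 (by decide))
  have h5 := hv.2 (Units.mkOfMulEqOne 5 41 (by decide))
  have h7 := hv.2 (Units.mkOfMulEqOne 7 39 (by decide))
  have h13 := hv.2 (Units.mkOfMulEqOne 13 21 (by decide))
  have h19 := hv.2 (Units.mkOfMulEqOne 19 43 (by decide))
  simp only [Units.val_mkOfMulEqOne] at h1 h3 h11 h5 h7 h13 h19
  exact ⟨hv.1.2, hv.1.1, h1, h3, h11, h5, h7, h13, h19⟩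

set_option maxHeartbeats 0 in
/-- The arithmetic heart of "`s` is **not quasi-decomposable**": for every `e ∈ ℤ/68` and every splitting `s + {e, −e} = t + u` into
non-empty parts different from `s`, one of `t`, `u` violates a condition of `hodgeConditions_sixtyEight` (the zero-sum test comes first, so
the kernel discards almost every splitting on one addition). Kernel, one residue `e` at a time (`68 · 2⁸` cases). [cite: daSilva2021HodgeFermat, Def. 2.4] [cite: Shioda1979PJA, §1 Definition (ii)] -/
theorem fail_sixtyEight_key :
    ∀ e : ZMod 68, ∀ t ∈ Multiset.powerset (({1, 18, 35, 38, 52, 60} : Multiset (ZMod 68)) + {e, -e}),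
      ¬ (((t).sum = 0 ∧ (∀ a ∈ t, a ≠ 0) ∧
            2 * mNormSum ((t).map fun a ↦ (1 : ZMod 68) * a) = 68 * Multiset.card (t) ∧
            2 * mNormSum ((t).map fun a ↦ (3 : ZMod 68) * a) = 68 * Multiset.card (t) ∧
            2 * mNormSum ((t).map fun a ↦ (11 : ZMod 68) * a) = 68 * Multiset.card (t) ∧
            2 * mNormSum ((t).map fun a ↦ (5 : ZMod 68) * a) = 68 * Multiset.card (t) ∧
            2 * mNormSum ((t).map fun a ↦ (7 : ZMod 68) * a) = 68 * Multiset.card (t) ∧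
            2 * mNormSum ((t).map fun a ↦ (13 : ZMod 68) * a) = 68 * Multiset.card (t) ∧
            2 * mNormSum ((t).map fun a ↦ (19 : ZMod 68) * a) = 68 * Multiset.card (t)) ∧
          (((({1, 18, 35, 38, 52, 60} : Multiset (ZMod 68)) + {e, -e}) - t).sum = 0 ∧ (∀ a ∈ (({1, 18, 35, 38, 52, 60} : Multiset (ZMod 68)) + {e, -e}) - t, a ≠ 0) ∧
            2 * mNormSum (((({1, 18, 35, 38, 52, 60} : Multiset (ZMod 68)) + {e, -e}) - t).map fun a ↦ (1 : ZMod 68) * a) = 68 * Multiset.card ((({1, 18, 35, 38, 52, 60} : Multiset (ZMod 68)) + {e, -e}) - t) ∧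
            2 * mNormSum (((({1, 18, 35, 38, 52, 60} : Multiset (ZMod 68)) + {e, -e}) - t).map fun a ↦ (3 : ZMod 68) * a) = 68 * Multiset.card ((({1, 18, 35, 38, 52, 60} : Multiset (ZMod 68)) + {e, -e}) - t) ∧
            2 * mNormSum (((({1, 18, 35, 38, 52, 60} : Multiset (ZMod 68)) + {e, -e}) - t).map fun a ↦ (11 : ZMod 68) * a) = 68 * Multiset.card ((({1, 18, 35, 38, 52, 60} : Multiset (ZMod 68)) + {e, -e}) - t) ∧
            2 * mNormSum (((({1, 18, 35, 38, 52, 60} : Multiset (ZMod 68)) + {e, -e}) - t).map fun a ↦ (5 : ZMod 68) * a) = 68 * Multiset.card ((({1, 18, 35, 38, 52, 60} : Multiset (ZMod 68)) + {e, -e}) - t) ∧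
            2 * mNormSum (((({1, 18, 35, 38, 52, 60} : Multiset (ZMod 68)) + {e, -e}) - t).map fun a ↦ (7 : ZMod 68) * a) = 68 * Multiset.card ((({1, 18, 35, 38, 52, 60} : Multiset (ZMod 68)) + {e, -e}) - t) ∧
            2 * mNormSum (((({1, 18, 35, 38, 52, 60} : Multiset (ZMod 68)) + {e, -e}) - t).map fun a ↦ (13 : ZMod 68) * a) = 68 * Multiset.card ((({1, 18, 35, 38, 52, 60} : Multiset (ZMod 68)) + {e, -e}) - t) ∧
            2 * mNormSum (((({1, 18, 35, 38, 52, 60} : Multiset (ZMod 68)) + {e, -e}) - t).map fun a ↦ (19 : ZMod 68) * a) = 68 * Multiset.card ((({1, 18, 35, 38, 52, 60} : Multiset (ZMod 68)) + {e, -e}) - t)) ∧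
          t ≠ 0 ∧ (({1, 18, 35, 38, 52, 60} : Multiset (ZMod 68)) + {e, -e}) - t ≠ 0 ∧ t ≠ ({1, 18, 35, 38, 52, 60} : Multiset (ZMod 68)) ∧ (({1, 18, 35, 38, 52, 60} : Multiset (ZMod 68)) + {e, -e}) - t ≠ ({1, 18, 35, 38, 52, 60} : Multiset (ZMod 68))) := by
  intro e
  obtain ⟨k, hk, rfl⟩ : ∃ k < 68, ((k : ℕ) : ZMod 68) = e :=
    ⟨e.val, e.val_lt, ZMod.natCast_zmod_val e⟩
  interval_cases k <;> decide +kernel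

/-- `s` is **not quasi-decomposable** (no `e ≠ 0` with `s + {e, −e} = ξ' + ξ''`, `ξ', ξ''` Hodge, both different from `s`).
[cite: daSilva2021HodgeFermat, Def. 2.4] [cite: Shioda1979PJA, §1 Definition (ii)] -/
theorem not_isQuasiDecomposable_fail_sixtyEight : ¬ IsQuasiDecomposable ({1, 18, 35, 38, 52, 60} : Multiset (ZMod 68)) := by
  rintro ⟨e, -, t, u, ht0, hu0, ht, hu, hts, hus, heq⟩
  have htle : t ≤ ({1, 18, 35, 38, 52, 60} : Multiset (ZMod 68)) + {e, -e} := heq ▸ Multiset.le_add_right t u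
  have hu' : ({1, 18, 35, 38, 52, 60} : Multiset (ZMod 68)) + {e, -e} - t = u := by rw [heq, add_tsub_cancel_left]
  subst hu'
  exact fail_sixtyEight_key e t (Multiset.mem_powerset.2 htle)
    ⟨hodgeConditions_sixtyEight ht, hodgeConditions_sixtyEight hu, ht0, hu0, hts, hus⟩

/-- **`(P⁴ₘ)` fails at `m = 68`** (Proc. Japan Acad. form, tree `ShiodaConditionUpTo 68 4`): the Hodge sextuple `s` is neither decomposable,
nor quasi-decomposable, nor semi-decomposable. Kernel certificate of the cell's P4-TABLE entry (two implementations + referee).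
[cite: Shioda1979PJA, §1 condition (Pⁿₘ)] -/
theorem not_shiodaConditionUpTo_sixtyEight_four : ¬ ShiodaConditionUpTo 68 4 := fun h ↦ by
  rcases h _ isHodgeMultiset_fail_sixtyEight (by decide) (by decide) with hd | hq | hs
  · exact not_isDecomposable_fail_sixtyEight hd
  · exact not_isQuasiDecomposable_fail_sixtyEight hq
  · exact not_isSemiDecomposable_fail_sixtyEight hs

/-- Hence `(Pₘ)` (Proc. Japan Acad. form, all lengths) fails at `m = 68`. [cite: Shioda1979PJA, §1 conditions (Pⁿₘ), (Pₘ)] -/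
theorem not_shiodaCondition_sixtyEight : ¬ ShiodaCondition 68 := fun h ↦
  not_shiodaConditionUpTo_sixtyEight_four (shiodaCondition_iff_forall_upTo.1 h 4)

/-- **The Math. Ann. form of `(P⁴ₘ)` fails at `m = 68`** too: `s` is indecomposable and not quasi-decomposable.
[cite: Shioda1979HodgeFermat, §3 condition (Pⁿₘ), p. 180] -/
theorem not_conditionP_sixtyEight_four : ¬ ConditionP 68 4 := fun h ↦
  not_isQuasiDecomposable_fail_sixtyEight
    (h _ isHodgeMultiset_fail_sixtyEight (by decide) (by decide) not_isDecomposable_fail_sixtyEight)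

/-- Hence the Math. Ann. condition `(Pₘ)` fails at `m = 68`. [cite: Shioda1979HodgeFermat, §3 condition (Pₘ), p. 180] -/
theorem not_conditionPAll_sixtyEight : ¬ ConditionPAll 68 := fun h ↦
  not_conditionP_sixtyEight_four (conditionPAll_iff_forall.1 h 4)

/-- **Shioda's question (Math. Ann. 245, p. 184), the fourfold instance at `m = 68`**: "we do not know any value of `m` which satisfies
`(Qₘ)` but not `(Pₘ)`" — at `m = 68` the length-`3` condition `(Q⁴ₘ)` HOLDS while `(P⁴ₘ)` FAILS (in both printed forms). Whether `(Qₘ)` holds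
at ALL lengths for `m = 68` is not decided here. Computer-assisted (cell `pub-hfermat`, two implementations), certified by the kernel.
[cite: Shioda1979HodgeFermat, §4, p. 184 (the question)] -/
theorem conditionQ_not_conditionP_sixtyEight : ConditionQ 68 4 ∧ ¬ ConditionP 68 4 :=
  ⟨conditionQ_sixtyEight_four, not_conditionP_sixtyEight_four⟩

end Summit.HodgeConjecture.FermatCycles.ConditionQFourfold
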